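import Mathlib.CategoryTheory.Endomorphism
import Literature.AlgebraicGeometry.Frobenioids.CategoriesFactorization
import Literature.AlgebraicGeometry.Frobenioids.ArchimedeanBaseCategory
import HarnessLib

/-!
# A two-object base category over `D₀` whose functor to `D₀` kills a quotient group
# (input of the kernel counterexample to [FrdII] Prop. 3.5 (i) as typed, finding P35i-F1)

Mochizuki, *The geometry of Frobenioids II: poly-Frobenioids*, Kyushu J. Math. **62** (2008)
401–460, §3, Proposition 3.5 (i), author's (kurims) text p. 34 [cite: MochizukiFrdII2008, Prop 3.5 (i) p.34],
and [FrdI] §0 p. 18 (categorical quotients, mono-minimality) [cite: MochizukiFrdI2008, §0 p.18].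

This file builds the TOY BASE CATEGORY used by `ArchimedeanProp35iCounterexample.lean` (seat
abc-iut-w5-d013, layer L1 of the abc-iut cell; sub-DAG `SUBDAG-FrdII-Thm36-Prop35`, rows P35-L01/L02):

* `ArchFrd.P35iToy.T` — two objects `b`, `a`; `Aut(b) = {σ^s τ^t} ≅ (ℤ/2)²`; one arrow `f : b → a`
  fixed by `Aut(b)`; `End(a) = {1}`; `Hom(a, b) = ∅`. PROVED: `T` is connected and totally epimorphic;
  the subgroup `G_D := {1, σ} ⊆ Aut(b)` (`T.GD`); `f : b → a` is a MONO-MINIMAL CATEGORICAL QUOTIENT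
  of `b` by `G_D` in the sense of [FrdI] §0 (`T.isMonoMinimalQuotient_fHom`).
* `ArchFrd.P35iToy.toD0 : T ⥤ D₀` — `b ↦ Spec ℂ`, `a ↦ Spec ℝ`, `σ ↦ 𝟙`, `τ ↦` complex conjugation,
  `f ↦ (Spec ℂ → Spec ℝ)`: a functor that KILLS the quotient group `G_D` (`toD0_map_sigma`).

Everything is finite and proved by case analysis; no `Prop`-valued fact is introduced. The point of the
construction is recorded in the companion file: [FrdII] Prop. 3.5 (i) as typed (`ArchFrd.Prop35i_C π`)
fails at `π = toD0`. Nothing here bears on [IUTchIII] Cor. 3.12; typed ≠ proved.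
-/

namespace Literature.AlgebraicGeometry.Frobenioids

open CategoryTheory

noncomputable section

namespace ArchFrd

namespace P35iToy
/-! ### The toy base category `T` -/

/-- The objects of the toy base category: `b` (to be sent to `Spec ℂ`) and `a` (to `Spec ℝ`).
[cite: MochizukiFrdII2008, Prop 3.5 (i) p.34] -/
inductive T : Type
  /-- the complex object `B_D` -/
  | b
  /-- the real object `A_D` -/
  | a
  deriving DecidableEq, Inhabited

namespace T

/-- Morphisms of `T`: `Aut(b) = (ℤ/2)²` (a `σ`-bit and a `τ`-bit), one arrow `f : b → a`, the
identity of `a`, and nothing from `a` to `b`. [cite: MochizukiFrdII2008, Prop 3.5 (i) p.34] -/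
inductive Hom : T → T → Type
  /-- the automorphism `σ^s τ^t` of `b` -/
  | auto (s t : Bool) : Hom b b
  /-- the quotient arrow `b → a` -/
  | f : Hom b a
  /-- the identity of `a` -/
  | ida : Hom a a
  deriving DecidableEq

/-- Composition (diagrammatic order). [cite: MochizukiFrdII2008, Prop 3.5 (i) p.34] -/
def Hom.comp : {X Y Z : T} → Hom X Y → Hom Y Z → Hom X Z
  | _, _, _, .auto s t, .auto s' t' => .auto (xor s s') (xor t t')
  | _, _, _, .auto _ _, .f => .f
  | _, _, _, .f, .ida => .f
  | _, _, _, .ida, .ida => .ida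

/-- Identities. [cite: MochizukiFrdII2008, Prop 3.5 (i) p.34] -/
def Hom.id : (X : T) → Hom X X
  | .b => .auto false false
  | .a => .ida

/-- `T` is a category (laws by cases on the finitely many arrows).
[cite: MochizukiFrdII2008, Prop 3.5 (i) p.34] -/
instance instCategory : Category T where
  Hom := Hom
  id := Hom.id
  comp := Hom.comp
  id_comp φ := by
    cases φ
    · simp only [Hom.id, Hom.comp, Bool.false_xor]
    · rfl
    · rfl
  comp_id φ := by
    cases φ
    · simp only [Hom.id, Hom.comp, Bool.xor_false]
    · rfl
    · rfl
  assoc φ ψ χ := by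
    cases φ <;> cases ψ <;> cases χ <;> simp only [Hom.comp, Bool.xor_assoc]

/-- The automorphism `σ^s τ^t` of `b`, as an arrow of the category `T`.
[cite: MochizukiFrdII2008, Prop 3.5 (i) p.34] -/
def au (s t : Bool) : b ⟶ b := Hom.auto s t

/-- The quotient arrow `b → a`, as an arrow of the category `T`.
[cite: MochizukiFrdII2008, Prop 3.5 (i) p.34] -/
def fHom : b ⟶ a := Hom.f

/-- Every arrow `b → b` is some `σ^s τ^t`. [cite: MochizukiFrdII2008, Prop 3.5 (i) p.34] -/
theorem hom_bb_eq (φ : b ⟶ b) : ∃ s t : Bool, φ = au s t := by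
  cases φ with
  | auto s t => exact ⟨s, t, rfl⟩

/-- `Hom(b, a)` is a singleton. [cite: MochizukiFrdII2008, Prop 3.5 (i) p.34] -/
instance subsingleton_hom_ba : Subsingleton (b ⟶ a) :=
  ⟨fun φ ψ => by cases φ; cases ψ; rfl⟩

/-- `End(a)` is a singleton. [cite: MochizukiFrdII2008, Prop 3.5 (i) p.34] -/
instance subsingleton_hom_aa : Subsingleton (a ⟶ a) :=
  ⟨fun φ ψ => by cases φ; cases ψ; rfl⟩

/-- `Hom(a, b)` is empty. [cite: MochizukiFrdII2008, Prop 3.5 (i) p.34] -/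
instance isEmpty_hom_ab : IsEmpty (a ⟶ b) :=
  ⟨fun φ => by cases φ⟩

/-- Composition of automorphisms of `b` adds the bits. [cite: MochizukiFrdII2008, Prop 3.5 (i) p.34] -/
@[simp] theorem au_comp_au (s t s' t' : Bool) : au s t ≫ au s' t' = au (xor s s') (xor t t') := rfl

/-- Composition with the quotient arrow. [cite: MochizukiFrdII2008, Prop 3.5 (i) p.34] -/
@[simp] theorem au_comp_fHom (s t : Bool) : au s t ≫ fHom = fHom := rfl

/-- The identity of `b` is `σ⁰ τ⁰`. [cite: MochizukiFrdII2008, Prop 3.5 (i) p.34] -/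
theorem id_b : (𝟙 b : b ⟶ b) = au false false := rfl

/-- The automorphism `σ^s τ^t` of `b` as an isomorphism (it is its own inverse).
[cite: MochizukiFrdII2008, Prop 3.5 (i) p.34] -/
def autoIso (s t : Bool) : b ≅ b where
  hom := au s t
  inv := au s t
  hom_inv_id := by rw [au_comp_au, Bool.xor_self, Bool.xor_self, id_b]
  inv_hom_id := by rw [au_comp_au, Bool.xor_self, Bool.xor_self, id_b]

/-- `σ := σ¹ τ⁰`, the automorphism of `b` that the base functor will KILL.
[cite: MochizukiFrdII2008, Prop 3.5 (i) p.34] -/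
def sigma : b ≅ b := autoIso true false

/-- `τ := σ⁰ τ¹`, the automorphism of `b` mapped to complex conjugation.
[cite: MochizukiFrdII2008, Prop 3.5 (i) p.34] -/
def tau : b ≅ b := autoIso false true

/-- `σ ≠ 1`. [cite: MochizukiFrdII2008, Prop 3.5 (i) p.34] -/
theorem sigma_hom_ne_id : sigma.hom ≠ 𝟙 b := by
  intro h
  have h' : Hom.auto true false = Hom.auto false false := h
  cases h'

/-- The `τ`-bit of an arrow `b → b`. [cite: MochizukiFrdII2008, Prop 3.5 (i) p.34] -/
def tauBit : (b ⟶ b) → Bool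
  | .auto _ t => t

/-- The `τ`-bit of `σ^s τ^t` is `t`. [cite: MochizukiFrdII2008, Prop 3.5 (i) p.34] -/
@[simp] theorem tauBit_au (s t : Bool) : tauBit (au s t) = t := rfl

/-- The `τ`-bit is additive. [cite: MochizukiFrdII2008, Prop 3.5 (i) p.34] -/
theorem tauBit_comp (φ ψ : b ⟶ b) : tauBit (φ ≫ ψ) = xor (tauBit φ) (tauBit ψ) := by
  obtain ⟨s, t, rfl⟩ := hom_bb_eq φ
  obtain ⟨s', t', rfl⟩ := hom_bb_eq ψ
  rfl

/-- The subgroup `G_D := {1, σ} ⊆ Aut(b)`: automorphisms with trivial `τ`-bit.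
[cite: MochizukiFrdII2008, Prop 3.5 (i) p.34] -/
def GD : Subgroup (Aut b) where
  carrier := {γ | tauBit γ.hom = false}
  one_mem' := rfl
  mul_mem' := by
    intro γ δ hγ hδ
    change tauBit (δ.hom ≫ γ.hom) = false
    rw [tauBit_comp, hγ, hδ]
    rfl
  inv_mem' := by
    intro γ hγ
    change tauBit γ.inv = false
    have h : tauBit (γ.hom ≫ γ.inv) = false := by rw [γ.hom_inv_id]; rfl
    rw [tauBit_comp, hγ, Bool.false_xor] at h
    exact h

/-- Membership in `G_D`. [cite: MochizukiFrdII2008, Prop 3.5 (i) p.34] -/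
theorem mem_GD_iff (γ : Aut b) : γ ∈ GD ↔ tauBit γ.hom = false := Iff.rfl

/-- `σ ∈ G_D`. [cite: MochizukiFrdII2008, Prop 3.5 (i) p.34] -/
theorem sigma_mem_GD : sigma ∈ GD := rfl

/-- `xor t t' = xor t' false` forces `t = false`. [folklore] -/
private theorem xor_eq_xor_false {t t' : Bool} (h : xor t t' = xor t' false) : t = false := by
  revert h
  revert t t'
  decide

/-- If `x ≫ e = e ≫ g` in `Aut(b)` with `g ∈ G_D` (τ-bit `false`), then `x` has τ-bit `false`
(the group is abelian). [cite: MochizukiFrdII2008, Prop 3.5 (i) p.34] -/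
theorem tauBit_eq_false_of_comm {x e g : b ⟶ b} (h : x ≫ e = e ≫ g) (hg : tauBit g = false) :
    tauBit x = false := by
  obtain ⟨s, t, rfl⟩ := hom_bb_eq x
  obtain ⟨s', t', rfl⟩ := hom_bb_eq e
  obtain ⟨s'', t'', rfl⟩ := hom_bb_eq g
  rw [tauBit_au] at hg ⊢
  subst hg
  have h' : Hom.auto (xor s s') (xor t t') = Hom.auto (xor s' s'') (xor t' false) := h
  obtain ⟨-, h2⟩ := Hom.auto.inj h'
  exact xor_eq_xor_false h2

/-- `T` is connected. [cite: MochizukiFrdII2008, Prop 3.5 (i) p.34] -/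
theorem isGraphConnected : IsGraphConnected T := by
  refine ⟨⟨a⟩, fun X Y => ?_⟩
  have h : ∀ K : T, Zigzag K a := fun K => by
    cases K
    · exact Zigzag.of_hom fHom
    · exact Zigzag.refl _
  exact (h X).trans (h Y).symm

/-- `T` is connected in Mathlib's sense. [cite: MochizukiFrdII2008, Prop 3.5 (i) p.34] -/
theorem isConnected : IsConnected T :=
  (isGraphConnected_iff_isConnected).mp isGraphConnected

/-- Left cancellation of `xor`. [folklore] -/
private theorem xor_cancel_left {s c c' : Bool} (h : xor s c = xor s c') : c = c' := by
  revert s c c'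
  decide

/-- `xor true s ≠ s`. [folklore] -/
private theorem true_xor_ne (s : Bool) : xor true s ≠ s := by
  cases s <;> decide

/-- `T` is totally epimorphic. [cite: MochizukiFrdII2008, Prop 3.5 (i) p.34] -/
theorem isTotallyEpimorphic : IsTotallyEpimorphic T := by
  refine ⟨fun {X Y} φ => ⟨fun {Z} g h hgh => ?_⟩⟩
  cases φ with
  | auto s t =>
    cases Z
    · obtain ⟨s₁, t₁, rfl⟩ := hom_bb_eq g
      obtain ⟨s₂, t₂, rfl⟩ := hom_bb_eq h
      have e : Hom.auto (xor s s₁) (xor t t₁) = Hom.auto (xor s s₂) (xor t t₂) := hgh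
      obtain ⟨e₁, e₂⟩ := Hom.auto.inj e
      rw [xor_cancel_left e₁, xor_cancel_left e₂]
    · exact Subsingleton.elim _ _
  | f =>
    cases Z
    · exact (isEmpty_hom_ab.false g).elim
    · exact Subsingleton.elim _ _
  | ida =>
    cases Z
    · exact (isEmpty_hom_ab.false g).elim
    · exact Subsingleton.elim _ _

/-- The arrow `f : b → a` is NOT a monomorphism (`1 ≫ f = σ ≫ f`).
[cite: MochizukiFrdII2008, Prop 3.5 (i) p.34] -/
theorem not_mono_fHom : ¬ Mono fHom := by
  intro h
  exact sigma_hom_ne_id (h.right_cancellation sigma.hom (𝟙 b) (Subsingleton.elim _ _))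

/-- `b → a` is a categorical quotient of `b` by `G_D = {1, σ}`: the only `G_D`-invariant arrow out
of `b` is `b → a` itself. [cite: MochizukiFrdII2008, Prop 3.5 (i) p.34] -/
theorem isCategoricalQuotient_fHom : IsCategoricalQuotient GD fHom := by
  refine ⟨fun γ _ => Subsingleton.elim _ _, fun X ψ hψ => ?_⟩
  cases X
  · exfalso
    obtain ⟨s, t, rfl⟩ := hom_bb_eq ψ
    have h := hψ sigma sigma_mem_GD
    have h' : Hom.auto (xor true s) (xor false t) = Hom.auto s t := h
    obtain ⟨h₁, -⟩ := Hom.auto.inj h'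
    exact true_xor_ne s h₁
  · exact ⟨𝟙 a, Subsingleton.elim _ _, fun _ _ => Subsingleton.elim _ _⟩

/-- `b → a` is a MONO-MINIMAL categorical quotient of `b` by `G_D`: a factorisation through a
monomorphism out of `b` has that monomorphism an automorphism of `b` (the other candidate, `b → a`
itself, is not mono). [cite: MochizukiFrdII2008, Prop 3.5 (i) p.34] -/
theorem isMonoMinimalQuotient_fHom : IsMonoMinimalQuotient GD fHom := by
  refine ⟨isCategoricalQuotient_fHom, fun A' ζ φ' _ hmono _ => ?_⟩
  cases A'
  · obtain ⟨s, t, rfl⟩ := hom_bb_eq ζ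
    exact ⟨⟨au s t, (autoIso s t).hom_inv_id, (autoIso s t).inv_hom_id⟩⟩
  · exfalso
    have hζ : ζ = fHom := Subsingleton.elim _ _
    subst hζ
    exact not_mono_fHom hmono

end T

open T

/-! ### The base functor `T → D₀` killing `σ` -/

/-- The object map: `b ↦ Spec ℂ`, `a ↦ Spec ℝ`. [cite: MochizukiFrdII2008, Prop 3.5 (i) p.34] -/
def toD0Obj : T → D0
  | .b => .complex
  | .a => .real

/-- The arrow map: `σ^s τ^t ↦` the Galois twist `t` (so `σ ↦ 𝟙`, `τ ↦` conjugation), `f ↦` the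
structure map, `1_a ↦ 1`. [cite: MochizukiFrdII2008, Prop 3.5 (i) p.34] -/
def toD0Map : {X Y : T} → (X ⟶ Y) → (toD0Obj X ⟶ toD0Obj Y)
  | _, _, .auto _ t => D0.Hom.gal t
  | _, _, .f => D0.Hom.toReal
  | _, _, .ida => D0.Hom.idReal

/-- The base functor `π := toD0 : T → D₀`. [cite: MochizukiFrdII2008, Prop 3.5 (i) p.34] -/
def toD0 : T ⥤ D0 where
  obj := toD0Obj
  map := toD0Map
  map_id X := by cases X <;> rfl
  map_comp φ ψ := by cases φ <;> cases ψ <;> rfl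

/-- `π(b) = Spec ℂ`. [cite: MochizukiFrdII2008, Prop 3.5 (i) p.34] -/
@[simp] theorem toD0_obj_b : toD0.obj b = D0.complex := rfl

/-- `π(a) = Spec ℝ`. [cite: MochizukiFrdII2008, Prop 3.5 (i) p.34] -/
@[simp] theorem toD0_obj_a : toD0.obj a = D0.real := rfl

/-- `π(σ^s τ^t) = gal t`. [cite: MochizukiFrdII2008, Prop 3.5 (i) p.34] -/
@[simp] theorem toD0_map_au (s t : Bool) : toD0.map (au s t) = D0.Hom.gal t := rfl

/-- `π` KILLS `σ`: `π(σ) = 𝟙_{Spec ℂ}`. [cite: MochizukiFrdII2008, Prop 3.5 (i) p.34] -/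
theorem toD0_map_sigma : toD0.map sigma.hom = 𝟙 D0.complex := rfl

/-- `π(τ)` is complex conjugation. [cite: MochizukiFrdII2008, Prop 3.5 (i) p.34] -/
theorem toD0_map_tau : toD0.map tau.hom = D0.conj := rfl

/-- In `D₀`: if `x ≫ i = i ≫ y` on `Spec ℂ` with `y = 𝟙`, then `x = 𝟙` (`Gal(ℂ/ℝ)` is abelian and every
arrow `Spec ℂ → Spec ℂ` is invertible). [cite: MochizukiFrdII2008, Def 3.1 (i) p.23] -/
theorem D0_eq_id_of_comm {x i y : D0.complex ⟶ D0.complex} (h : x ≫ i = i ≫ y)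
    (hy : y = 𝟙 D0.complex) : x = 𝟙 D0.complex := by
  subst hy
  cases x with
  | gal σ =>
    cases i with
    | gal τ =>
      have h' : D0.Hom.gal (xor σ τ) = D0.Hom.gal (xor τ false) := h
      have hσ : σ = false := T.xor_eq_xor_false (D0.Hom.gal.inj h')
      subst hσ
      rfl

end P35iToy

end ArchFrd

end

end Literature.AlgebraicGeometry.Frobenioids
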